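import Literature.AlgebraicGeometry.Motives.MixedHodgeStructureCatInternalHomIsos
import Literature.AlgebraicGeometry.Motives.MixedHodgeStructureTensorAssoc
import HarnessLib

/-!
# The symmetric monoidal data of `MixedHodgeStructureCat` on finite-dimensional objects: associator, braiding, unitors, and their coherence

Layer `Literature/AlgebraicGeometry/Motives` (lane `lit-hodgefound`), continuing g45-#13 ∕ #14 (`tensorObj`, `tensorHom`, `unitObj = ℚ(0)`,
`tensorUnitIso : ℚ(0) ⊗ X ≅ X`).  The tree proves, unbundled, that the associativity `(H₁ ⊗ H₂) ⊗ H₃ → H₁ ⊗ (H₂ ⊗ H₃)` (`tensorAssoc`,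
`Motives/MixedHodgeStructureTensorAssoc`), the symmetry `H₁ ⊗ H₂ → H₂ ⊗ H₁` (`tensorComm`, `…TensorMorphisms`) and the unit `ℚ(0) ⊗ H → H`
(`unitTensorHom`, `…TensorTate`) are isomorphisms of mixed Hodge structures (Deligne, *Hodge II*, 1.1.12: `⊗` of filtered objects is associative,
commutative and unital; El Zein–Lê §3.2.2.7).  Here they become the STRUCTURE ISOMORPHISMS of `MixedHodgeStructureCat` with their naturality and the
Mac Lane coherence identities — everything a `MonoidalCategory` ∕ `SymmetricCategory` structure on the finite-dimensional objects requires, stated as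
theorems (this lane declares no instances):

* §1 **`associator X Y Z : (X ⊗ Y) ⊗ Z ≅ X ⊗ (Y ⊗ Z)`**, **`braiding X Y : X ⊗ Y ≅ Y ⊗ X`**, **`leftUnitor X : ℚ(0) ⊗ X ≅ X`**,
  **`rightUnitor X : X ⊗ ℚ(0) ≅ X`**, with their values on pure tensors and their NATURALITY (`associator_naturality`, `braiding_naturality`,
  `leftUnitor_naturality`, `rightUnitor_naturality`), `braiding_symm`, `symmetry`;
* §2 COHERENCE: **`pentagon`**, **`triangle`**, **`hexagon_forward`**, **`hexagon_reverse`** (in Mathlib's normal forms);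
* §3 on `FinSubcategory`: the functor `tensorLeft X` (`Y ↦ X ⊗ Y`) and the curried **bifunctor `tensorBifunctor : FinSubcategory ⥤ FinSubcategory ⥤
  FinSubcategory`**, the unit object `finUnitObj`.

Everything is PROVED (coherence by evaluation on pure tensors, Mathlib `TensorProduct.ext_threefold` ∕ `ext_fourfold`); no named fact, no instance,
no notation.  Data: the four structure isomorphisms, `tensorLeft`, `tensorBifunctor`, `finUnitObj`.

Sources, verbatim (through the tree's files).  P. Deligne, *Théorie de Hodge II* (1971) [DeligneHodgeII1971], 1.1.12 (tensor products of filtered objects;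
«Ces constructions sont compatibles … à l'associativité, la commutativité»), 2.1.13 (`H ⊗ ℤ(0) = H`).  P. Deligne, J. S. Milne, *Tannakian categories*, LNM 900
(1982) [DeligneMilne1982Tannakian], §1 (1.0.1)–(1.0.2) (associativity and commutativity constraints, the pentagon and hexagon axioms), (1.3) (identity object).
S. Mac Lane, *Categories for the Working Mathematician* (coherence) through Mathlib's `MonoidalCategory` axioms [folklore for the normal forms].
E. Cattani et al. (eds.), *Hodge Theory* (2014) [CattaniElZeinGriffithsLe2014], Ch. 3 §3.2.2.7 p. 163.

## Main results

* §1 **`associator`** (`_hom_toLinearMap_apply_tmul`, `_inv_toLinearMap_apply_tmul`), **`associator_naturality`**, **`braiding`**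
  (`_hom_toLinearMap_apply_tmul`), **`braiding_naturality`**, `braiding_symm`, `symmetry`, **`leftUnitor`**, `leftUnitor_hom_toLinearMap_apply_tmul`,
  **`leftUnitor_naturality`**, **`rightUnitor`**, `rightUnitor_hom_toLinearMap_apply_tmul`, **`rightUnitor_naturality`**.
* §2 **`pentagon`**, **`triangle`**, **`hexagon_forward`**, **`hexagon_reverse`**.
* §3 `finUnitObj`, **`tensorLeft`** (`_obj`, `_map_hom`), **`tensorBifunctor`** (`_obj`, `_map_app_hom`).

## References

* [DeligneHodgeII1971] P. Deligne, Théorie de Hodge II, Publ. Math. IHÉS 40 (1971), 1.1.12, 2.1.13.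
* [DeligneMilne1982Tannakian] P. Deligne, J. S. Milne, Tannakian categories, in LNM 900 (1982), §1 (1.0.1)–(1.0.2), (1.3).
* [CattaniElZeinGriffithsLe2014] E. Cattani et al. (eds.), Hodge Theory, Princeton Math. Notes 49 (2014), Ch. 3 §3.2.2.7 p. 163.

## Provenance

Lane `lit-hodgefound` (summit `HodgeConjecture`), seat `lit-hodgefound-p36` (literature-prover, generation 45, row g45-#15).
-/

noncomputable section

open CategoryTheory CategoryTheory.Limits
open scoped TensorProduct

namespace Literature.AlgebraicGeometry.Motives

universe u

namespace MixedHodgeStructureCat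

/-! ## §1 The structure isomorphisms and their naturality -/

section Structure

variable {W X X' Y Y' Z Z' : MixedHodgeStructureCat.{u}} [Module.Finite ℚ W] [Module.Finite ℚ X] [Module.Finite ℚ X'] [Module.Finite ℚ Y]
  [Module.Finite ℚ Y'] [Module.Finite ℚ Z] [Module.Finite ℚ Z']

variable (X Y Z) in
/-- **The associator `(X ⊗ Y) ⊗ Z ≅ X ⊗ (Y ⊗ Z)`** (the tree's `tensorAssoc` ∕ `tensorAssocInv`). [cite: DeligneHodgeII1971, 1.1.12]
[cite: DeligneMilne1982Tannakian, §1 (1.0.1)] -/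
def associator : tensorObj (tensorObj X Y) Z ≅ tensorObj X (tensorObj Y Z) where
  hom := MixedHodgeStructure.tensorAssoc X.str Y.str Z.str
  inv := MixedHodgeStructure.tensorAssocInv X.str Y.str Z.str
  hom_inv_id := MixedHodgeStructure.tensorAssocInv_comp_tensorAssoc X.str Y.str Z.str
  inv_hom_id := MixedHodgeStructure.tensorAssoc_comp_tensorAssocInv X.str Y.str Z.str

/-- `α ((x ⊗ y) ⊗ z) = x ⊗ (y ⊗ z)`. [cite: DeligneHodgeII1971, 1.1.12] -/
theorem associator_hom_toLinearMap_apply_tmul (x : X) (y : Y) (z : Z) :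
    (associator X Y Z).hom.toLinearMap ((x ⊗ₜ[ℚ] y) ⊗ₜ[ℚ] z) = x ⊗ₜ[ℚ] (y ⊗ₜ[ℚ] z) := rfl

/-- `α⁻¹ (x ⊗ (y ⊗ z)) = (x ⊗ y) ⊗ z`. [cite: DeligneHodgeII1971, 1.1.12] -/
theorem associator_inv_toLinearMap_apply_tmul (x : X) (y : Y) (z : Z) :
    (associator X Y Z).inv.toLinearMap (x ⊗ₜ[ℚ] (y ⊗ₜ[ℚ] z)) = (x ⊗ₜ[ℚ] y) ⊗ₜ[ℚ] z :=
  MixedHodgeStructure.tensorAssocInv_apply_tmul X.str Y.str Z.str x y z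

/-- **Naturality of the associator**: `((f ⊗ g) ⊗ h) ≫ α = α ≫ (f ⊗ (g ⊗ h))`. [cite: DeligneMilne1982Tannakian, §1 (1.0.1)] -/
theorem associator_naturality (f : X ⟶ X') (g : Y ⟶ Y') (h : Z ⟶ Z') :
    tensorHom (tensorHom f g) h ≫ (associator X' Y' Z').hom = (associator X Y Z).hom ≫ tensorHom f (tensorHom g h) :=
  hom_ext (TensorProduct.ext_threefold fun _ _ _ => rfl)

variable (X Y) in
/-- **The braiding (symmetry) `X ⊗ Y ≅ Y ⊗ X`**, `x ⊗ y ↦ y ⊗ x` (the tree's `tensorComm`). [cite: DeligneHodgeII1971, 1.1.12] [cite: DeligneMilne1982Tannakian, §1 (1.0.2)] -/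
def braiding : tensorObj X Y ≅ tensorObj Y X where
  hom := MixedHodgeStructure.tensorComm X.str Y.str
  inv := MixedHodgeStructure.tensorComm Y.str X.str
  hom_inv_id := MixedHodgeStructure.tensorComm_comp_tensorComm X.str Y.str
  inv_hom_id := MixedHodgeStructure.tensorComm_comp_tensorComm Y.str X.str

/-- `β (x ⊗ y) = y ⊗ x`. [cite: DeligneHodgeII1971, 1.1.12] -/
theorem braiding_hom_toLinearMap_apply_tmul (x : X) (y : Y) : (braiding X Y).hom.toLinearMap (x ⊗ₜ[ℚ] y) = y ⊗ₜ[ℚ] x := rfl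

/-- `β⁻¹ (y ⊗ x) = x ⊗ y`. [cite: DeligneHodgeII1971, 1.1.12] -/
theorem braiding_inv_toLinearMap_apply_tmul (x : X) (y : Y) : (braiding X Y).inv.toLinearMap (y ⊗ₜ[ℚ] x) = x ⊗ₜ[ℚ] y := rfl

/-- **Naturality of the braiding**: `(f ⊗ g) ≫ β = β ≫ (g ⊗ f)`. [cite: DeligneMilne1982Tannakian, §1 (1.0.2)] -/
theorem braiding_naturality (f : X ⟶ X') (g : Y ⟶ Y') : tensorHom f g ≫ (braiding X' Y').hom = (braiding X Y).hom ≫ tensorHom g f :=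
  hom_ext (TensorProduct.ext' fun _ _ => rfl)

variable (X Y) in
/-- The braiding is SYMMETRIC: `β_{Y,X} = β_{X,Y}⁻¹`. [cite: DeligneMilne1982Tannakian, §1 (1.0.2)] -/
theorem braiding_symm : (braiding X Y).symm = braiding Y X := rfl

variable (X Y) in
/-- `β_{X,Y} ≫ β_{Y,X} = 𝟙`. [cite: DeligneMilne1982Tannakian, §1 (1.0.2)] -/
theorem symmetry : (braiding X Y).hom ≫ (braiding Y X).hom = 𝟙 (tensorObj X Y) := (braiding X Y).hom_inv_id

variable (X) in
/-- **The left unitor `ℚ(0) ⊗ X ≅ X`**, `q ⊗ x ↦ q • x` (g45-#14 `tensorUnitIso`). [cite: DeligneHodgeII1971, 2.1.13] [cite: DeligneMilne1982Tannakian, §1 (1.3)] -/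
abbrev leftUnitor : tensorObj unitObj.{u} X ≅ X := tensorUnitIso X

/-- `λ (q ⊗ x) = q • x`. [cite: DeligneHodgeII1971, 2.1.13] -/
theorem leftUnitor_hom_toLinearMap_apply_tmul (q : unitObj.{u}) (x : X) : (leftUnitor X).hom.toLinearMap (q ⊗ₜ[ℚ] x) = q.down • x :=
  tensorUnitHom_toLinearMap_apply_tmul q x

/-- **Naturality of the left unitor**: `(𝟙 ⊗ f) ≫ λ = λ ≫ f`. [cite: DeligneMilne1982Tannakian, §1 (1.3)] -/
theorem leftUnitor_naturality (f : X ⟶ X') : tensorHom (𝟙 unitObj.{u}) f ≫ (leftUnitor X').hom = (leftUnitor X).hom ≫ f := by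
  apply hom_ext
  refine TensorProduct.ext' fun q x => ?_
  rw [comp_toLinearMap, comp_toLinearMap, LinearMap.comp_apply, LinearMap.comp_apply, tensorHom_toLinearMap_apply_tmul,
    leftUnitor_hom_toLinearMap_apply_tmul, leftUnitor_hom_toLinearMap_apply_tmul, map_smul]
  rfl

variable (X) in
/-- **The right unitor `X ⊗ ℚ(0) ≅ X`**, `x ⊗ q ↦ q • x` (braiding followed by the left unitor). [cite: DeligneHodgeII1971, 2.1.13] [cite: DeligneMilne1982Tannakian, §1 (1.3)] -/
def rightUnitor : tensorObj X unitObj.{u} ≅ X := braiding X unitObj.{u} ≪≫ tensorUnitIso X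

/-- `ρ (x ⊗ q) = q • x`. [cite: DeligneHodgeII1971, 2.1.13] -/
theorem rightUnitor_hom_toLinearMap_apply_tmul (x : X) (q : unitObj.{u}) : (rightUnitor X).hom.toLinearMap (x ⊗ₜ[ℚ] q) = q.down • x :=
  tensorUnitHom_toLinearMap_apply_tmul q x

/-- **Naturality of the right unitor**: `(f ⊗ 𝟙) ≫ ρ = ρ ≫ f`. [cite: DeligneMilne1982Tannakian, §1 (1.3)] -/
theorem rightUnitor_naturality (f : X ⟶ X') : tensorHom f (𝟙 unitObj.{u}) ≫ (rightUnitor X').hom = (rightUnitor X).hom ≫ f := by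
  apply hom_ext
  refine TensorProduct.ext' fun x q => ?_
  rw [comp_toLinearMap, comp_toLinearMap, LinearMap.comp_apply, LinearMap.comp_apply, tensorHom_toLinearMap_apply_tmul,
    rightUnitor_hom_toLinearMap_apply_tmul, rightUnitor_hom_toLinearMap_apply_tmul, map_smul]
  rfl

/-! ## §2 Coherence -/

variable (W X Y Z) in
/-- **The pentagon identity** for the associator. [cite: DeligneMilne1982Tannakian, §1 (1.0.1) «the pentagon axiom»] -/
theorem pentagon :
    tensorHom (associator W X Y).hom (𝟙 Z) ≫ (associator W (tensorObj X Y) Z).hom ≫ tensorHom (𝟙 W) (associator X Y Z).hom =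
      (associator (tensorObj W X) Y Z).hom ≫ (associator W X (tensorObj Y Z)).hom :=
  hom_ext (TensorProduct.ext_fourfold fun _ _ _ _ => rfl)

variable (X Y) in
/-- **The triangle identity** for the associator and the unitors. [cite: DeligneMilne1982Tannakian, §1 (1.3)] -/
theorem triangle : (associator X unitObj.{u} Y).hom ≫ tensorHom (𝟙 X) (leftUnitor Y).hom = tensorHom (rightUnitor X).hom (𝟙 Y) := by
  apply hom_ext
  refine TensorProduct.ext_threefold fun x q y => ?_
  rw [comp_toLinearMap, LinearMap.comp_apply, associator_hom_toLinearMap_apply_tmul, tensorHom_toLinearMap_apply_tmul, tensorHom_toLinearMap_apply_tmul,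
    leftUnitor_hom_toLinearMap_apply_tmul, rightUnitor_hom_toLinearMap_apply_tmul, TensorProduct.tmul_smul, TensorProduct.smul_tmul']
  rfl

variable (X Y Z) in
/-- **The (forward) hexagon identity** for the associator and the braiding. [cite: DeligneMilne1982Tannakian, §1 (1.0.2) «the hexagon axiom»] -/
theorem hexagon_forward :
    (associator X Y Z).hom ≫ (braiding X (tensorObj Y Z)).hom ≫ (associator Y Z X).hom =
      tensorHom (braiding X Y).hom (𝟙 Z) ≫ (associator Y X Z).hom ≫ tensorHom (𝟙 Y) (braiding X Z).hom :=
  hom_ext (TensorProduct.ext_threefold fun _ _ _ => rfl)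

variable (X Y Z) in
/-- **The reverse hexagon identity.** [cite: DeligneMilne1982Tannakian, §1 (1.0.2)] -/
theorem hexagon_reverse :
    (associator X Y Z).inv ≫ (braiding (tensorObj X Y) Z).hom ≫ (associator Z X Y).inv =
      tensorHom (𝟙 X) (braiding Y Z).hom ≫ (associator X Z Y).inv ≫ tensorHom (braiding X Z).hom (𝟙 Y) := by
  apply hom_ext
  refine TensorProduct.ext_threefold' fun x y z => ?_
  simp only [comp_toLinearMap, LinearMap.comp_apply]
  rw [associator_inv_toLinearMap_apply_tmul, braiding_hom_toLinearMap_apply_tmul, associator_inv_toLinearMap_apply_tmul,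
    tensorHom_toLinearMap_apply_tmul, braiding_hom_toLinearMap_apply_tmul, associator_inv_toLinearMap_apply_tmul, tensorHom_toLinearMap_apply_tmul,
    braiding_hom_toLinearMap_apply_tmul]
  rfl

end Structure

/-! ## §3 The tensor bifunctor on the finite-dimensional full subcategory -/

section Functors

/-- The unit object `ℚ(0)` of `FinSubcategory`. [cite: DeligneMilne1982Tannakian, §1 (1.3)] -/
def finUnitObj : FinSubcategory.{u} := ⟨unitObj.{u}, finite_unitObj⟩

/-- **The functor `X ⊗ − : Y ↦ X ⊗ Y`** on `FinSubcategory` (`g ↦ 𝟙 ⊗ g`). [cite: DeligneHodgeII1971, 1.1.12] -/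
def tensorLeft (X : FinSubcategory.{u}) : FinSubcategory.{u} ⥤ FinSubcategory.{u} where
  obj Y := finTensorObj X Y
  map {Y Y'} g :=
    haveI : Module.Finite ℚ X.obj := X.property
    haveI : Module.Finite ℚ Y.obj := Y.property
    haveI : Module.Finite ℚ Y'.obj := Y'.property
    ObjectProperty.homMk (tensorHom (𝟙 X.obj) g.hom)
  map_id Y := by
    apply isFinite.hom_ext
    haveI : Module.Finite ℚ X.obj := X.property
    haveI : Module.Finite ℚ Y.obj := Y.property
    exact tensorHom_id X.obj Y.obj
  map_comp {Y Y' Y''} g g' := by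
    apply isFinite.hom_ext
    haveI : Module.Finite ℚ X.obj := X.property
    haveI : Module.Finite ℚ Y.obj := Y.property
    haveI : Module.Finite ℚ Y'.obj := Y'.property
    haveI : Module.Finite ℚ Y''.obj := Y''.property
    change tensorHom (𝟙 X.obj) (g.hom ≫ g'.hom) = tensorHom (𝟙 X.obj) g.hom ≫ tensorHom (𝟙 X.obj) g'.hom
    rw [← tensorHom_comp, Category.id_comp]

/-- Unfolding `tensorLeft` on objects. [cite: DeligneHodgeII1971, 1.1.12] -/
theorem tensorLeft_obj (X Y : FinSubcategory.{u}) : (tensorLeft X).obj Y = finTensorObj X Y := rfl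

/-- Unfolding `tensorLeft` on morphisms. [cite: DeligneHodgeII1971, 1.1.12] -/
theorem tensorLeft_map_hom (X : FinSubcategory.{u}) {Y Y' : FinSubcategory.{u}} (g : Y ⟶ Y') :
    ((tensorLeft X).map g).hom =
      haveI : Module.Finite ℚ X.obj := X.property
      haveI : Module.Finite ℚ Y.obj := Y.property
      haveI : Module.Finite ℚ Y'.obj := Y'.property
      tensorHom (𝟙 X.obj) g.hom := rfl

/-- **The tensor product as a bifunctor `FinSubcategory ⥤ FinSubcategory ⥤ FinSubcategory`** (`X ↦ X ⊗ −`; a morphism `f : X ⟶ X'` acts by the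
natural transformation `f ⊗ 𝟙`). [cite: DeligneHodgeII1971, 1.1.12] [cite: DeligneMilne1982Tannakian, §1 (1.0.1)] -/
def tensorBifunctor : FinSubcategory.{u} ⥤ FinSubcategory.{u} ⥤ FinSubcategory.{u} where
  obj X := tensorLeft X
  map {X X'} f :=
    { app := fun Y =>
        haveI : Module.Finite ℚ X.obj := X.property
        haveI : Module.Finite ℚ X'.obj := X'.property
        haveI : Module.Finite ℚ Y.obj := Y.property
        ObjectProperty.homMk (tensorHom f.hom (𝟙 Y.obj))
      naturality := fun {Y Y'} g => by
        apply isFinite.hom_ext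
        haveI : Module.Finite ℚ X.obj := X.property
        haveI : Module.Finite ℚ X'.obj := X'.property
        haveI : Module.Finite ℚ Y.obj := Y.property
        haveI : Module.Finite ℚ Y'.obj := Y'.property
        change tensorHom (𝟙 X.obj) g.hom ≫ tensorHom f.hom (𝟙 Y'.obj) = tensorHom f.hom (𝟙 Y.obj) ≫ tensorHom (𝟙 X'.obj) g.hom
        rw [← tensorHom_comp, ← tensorHom_comp, Category.id_comp, Category.comp_id, Category.id_comp, Category.comp_id] }
  map_id X := by
    refine NatTrans.ext (funext fun Y => ?_)
    apply isFinite.hom_ext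
    haveI : Module.Finite ℚ X.obj := X.property
    haveI : Module.Finite ℚ Y.obj := Y.property
    exact tensorHom_id X.obj Y.obj
  map_comp {X X' X''} f f' := by
    refine NatTrans.ext (funext fun Y => ?_)
    apply isFinite.hom_ext
    haveI : Module.Finite ℚ X.obj := X.property
    haveI : Module.Finite ℚ X'.obj := X'.property
    haveI : Module.Finite ℚ X''.obj := X''.property
    haveI : Module.Finite ℚ Y.obj := Y.property
    change tensorHom (f.hom ≫ f'.hom) (𝟙 Y.obj) = tensorHom f.hom (𝟙 Y.obj) ≫ tensorHom f'.hom (𝟙 Y.obj)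
    rw [← tensorHom_comp, Category.id_comp]

/-- Unfolding `tensorBifunctor` on objects. [cite: DeligneHodgeII1971, 1.1.12] -/
theorem tensorBifunctor_obj (X : FinSubcategory.{u}) : tensorBifunctor.obj X = tensorLeft X := rfl

/-- Unfolding `tensorBifunctor` on morphisms. [cite: DeligneHodgeII1971, 1.1.12] -/
theorem tensorBifunctor_map_app_hom {X X' : FinSubcategory.{u}} (f : X ⟶ X') (Y : FinSubcategory.{u}) :
    ((tensorBifunctor.map f).app Y).hom =
      haveI : Module.Finite ℚ X.obj := X.property
      haveI : Module.Finite ℚ X'.obj := X'.property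
      haveI : Module.Finite ℚ Y.obj := Y.property
      tensorHom f.hom (𝟙 Y.obj) := rfl

end Functors

end MixedHodgeStructureCat

end Literature.AlgebraicGeometry.Motives
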